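/-
Origin: expansion seat `prover-pub-hodgecm-mc-sinst-1-g2-0`, handover #1204 2026-08-19T23:23Z md5 306300b19ece (203 l.) NEW additive leaf; η at the det-twist form on the S side: plane-torus dets, eta_k (1,u) = χW u for all four lines, shared Stage-B family terms EtaChi.η/hη/hηc + χOfType; install after #1099 (any revision: r3c installed RUN 37, or period-1's RUN-38 r5b — only `eta₀…eta₃`/`dW'`/`isoGL_hg₀` are used, unchanged across revisions) + WmInstanceV2Term; drop alone on bounce (`HOME/mc/pub-hodgecm-mc-sinst-1-g2/stage/HodgeCM/Model/ThetaAdelicSideEta.lean`, md5 306300b19ece, 203 lines);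
landed by the second packager (p2) in gate run 38 as `HodgeCM/Model/ThetaAdelicSideEta.lean` (verbatim).
-/
/-
HodgeCM/Model/ThetaAdelicSideEta.lean — sinst-1 lane (unit pub-hodgecm-mc-sinst-1-g2, seat prover-pub-hodgecm-mc-sinst-1-g2-0, 2026-08-19/20),
BINDER-OWNERS row 5 `S`: the shared twist character `η` of the S and W pins AT THE DET-TWIST FORM OF RECORD
`η = (χ_V ∘ det_V) · (χ_W ∘ det_W)` (tree `cmDetTwistChar`, [GelbartRogawski1991, §3.1 Remark p. 457 L9–13]; the W block of record
`wmInputCM₂b` / TERM form `wmInputCM₂t`, `HodgeCM/Model/WmInstanceV2{,Term}.lean`), read on the S side.  Memo `mc/pub-hodgecm-mc-sinst-1-g2/notes/ETA-S-NORM.md`.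

§1 (PKG-side helpers, ns `HodgeCM.Model`) the determinant of the plane tori: `cmAdelicDet_cmPlaneTorus (u₀,u₁) = u₀ * u₁`,
   `cmAdelicDet_cmConjPlaneTorus (u₀,u₁) = u₀ * u₁` (conjugation-invariance), hence of their one-parameter factors.
§2 (ns `HodgeCM.Model.ArchSideTerm`) **the η-split of record at the det-twist form is LINE-INDEPENDENT in the torus variable**:
   `eta₀ V S (cmDetTwistChar … χV χW) (v, u) = χV (cmAdelicDet v) * χW u`, `eta₁ … (v, u) = χW u`, `eta₂ … (v, u) = χV (cmAdelicDet v) * χW u`,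
   `eta₃ … (v, u) = χW u`; at `v = 1`: `eta_k … (1, u) = χW u` for k = 0, 1, 2, 3 (`eta_detTwist_one_apply`, uniform in `k`) — the η-factor of
   theta-3's (J-μ)_k (`ArchLineInputOf.lean`, fields `hμ₀…hμ₃`) is ONE character `χW` for all four lines.
§3 (ns `HodgeCM.Model.EtaChi`) the three SHARED FAMILY TERMS for Stage B of the END-STATE corollary, over DATA families
   `χV χW : ∀ {L ι₁} V c, ContinuousMonoidHom ([U(1)]_L) Circle` (inhabited types, no `Prop` binder): `EtaChi.η @χV @χW` (= the W block's η at
   `(frameD V, dW c.D)`), `EtaChi.hη` (trivial on rational points, `cmDetTwistChar_eq_one_of_unitaryLineChar`), `EtaChi.hηc` (continuous values,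
   `continuous_cmDetTwistChar_of_unitaryLineChar`) — so that BOTH pins are instantiated at the SAME η TERM:
   `W := Gen12Pins.Wg @hGR @(EtaChi.η @χV @χW) @(EtaChi.hη @χV @χW) @(EtaChi.hηc @χV @χW) …`, `S := SInstance.S(A) @hGR @(EtaChi.η …) @(EtaChi.hη …) @(EtaChi.hηc …) …`;
   and the TERM form `EtaChi.χOfType @n := fun V c => unitaryLineCharOfType (n V c)` (unitary-1 `WmInstanceV2Term`, chosen once from the tree
   existence theorem; archimedean type `n V c` by `hasArchType_unitaryLineCharOfType`) for binder-2's read-off vectors `nVOf` / `nWOf`.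

KERNEL ONLY: 0 records, 0 `def … : Prop`, nothing cited as a hypothesis, MODEL-N ±0, E TYPE ±0.  Imports: period-1 #1099 `ArchSideOf` (RUN 37) and the
RUN-36-installed `WmInstanceV2Term` (→ twins `UnitaryLineCharacters`, `…CMTwistDet`).
-/
import Summits.HodgeConjecture.HodgeCM.Model.ArchSideOf_2
import Summits.HodgeConjecture.HodgeCM.Model.WmInstanceV2Term

set_option autoImplicit false

noncomputable section

open scoped Matrix
open NumberField
open Literature.NumberTheory.Automorphic Literature.NumberTheory.Weil1964
open Literature.NumberTheory.GelbartRogawski1991.UnitaryDualPair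
open HodgeCM.Adelic HodgeCM.PerL34

namespace HodgeCM.Model

/-! ## §1 Determinants of the plane tori -/

section Det

variable (F : Type) [Field F] [NumberField F] [IsCMField F] (a b : Fin 2 → F) (ha0 : ∀ i, a i ≠ 0) (g₀ : GL (Fin 2) F)
  (hg₀ : ((g₀ : Matrix (Fin 2) (Fin 2) F).map (IsCMField.complexConj F : F →+* F))ᵀ * Matrix.diagonal a *
    (g₀ : Matrix (Fin 2) (Fin 2) F) = Matrix.diagonal b)

/-- `det (diag(u₀, u₁)) = u₀ · u₁` for the plane's diagonal torus. -/
theorem cmAdelicDet_cmPlaneTorus (u₀ u₁ : CMAdelicOne F) :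
    cmAdelicDet F a ha0 (cmPlaneTorus F a (u₀, u₁)) = u₀ * u₁ := by
  apply Subtype.ext
  apply Units.ext
  change (((cmPlaneTorus F a (u₀, u₁) : CMAdelic F a) : GL (Fin (1 + 1)) (AdeleRing (𝓞 F) F)) :
      Matrix (Fin (1 + 1)) (Fin (1 + 1)) (AdeleRing (𝓞 F) F)).det = _
  rw [val_cmPlaneTorus, Matrix.det_diagonal, Fin.prod_univ_two]
  simp

/-- `det (g₀ · diag(u₀, u₁) · g₀⁻¹) = u₀ · u₁` for the conjugated torus. -/
theorem cmAdelicDet_cmConjPlaneTorus (hb0 : ∀ i, b i ≠ 0) (u₀ u₁ : CMAdelicOne F) :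
    cmAdelicDet F a ha0 (cmConjPlaneTorus F a b g₀ hg₀ (u₀, u₁)) = u₀ * u₁ := by
  apply Subtype.ext
  rw [coe_cmAdelicDet, coe_cmConjPlaneTorus, map_mul, map_mul, map_inv, mul_inv_cancel_comm,
    ← coe_cmAdelicDet F b hb0, cmAdelicDet_cmPlaneTorus]

/-- `det (diag(u, 1)) = u`. -/
theorem cmAdelicDet_cmPlaneTorusInl (u : CMAdelicOne F) : cmAdelicDet F a ha0 (cmPlaneTorusInl F a u) = u := by
  rw [cmPlaneTorusInl, MonoidHom.comp_apply, MonoidHom.inl_apply, cmAdelicDet_cmPlaneTorus, mul_one]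

/-- `det (diag(1, u)) = u`. -/
theorem cmAdelicDet_cmPlaneTorusInr (u : CMAdelicOne F) : cmAdelicDet F a ha0 (cmPlaneTorusInr F a u) = u := by
  rw [cmPlaneTorusInr, MonoidHom.comp_apply, MonoidHom.inr_apply, cmAdelicDet_cmPlaneTorus, one_mul]

/-- `det (g₀ · diag(u, 1) · g₀⁻¹) = u`. -/
theorem cmAdelicDet_cmConjPlaneTorusInl (hb0 : ∀ i, b i ≠ 0) (u : CMAdelicOne F) :
    cmAdelicDet F a ha0 (cmConjPlaneTorusInl F a b g₀ hg₀ u) = u := by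
  rw [cmConjPlaneTorusInl, MonoidHom.comp_apply, MonoidHom.inl_apply, cmAdelicDet_cmConjPlaneTorus F a b ha0 g₀ hg₀ hb0, mul_one]

/-- `det (g₀ · diag(1, u) · g₀⁻¹) = u`. -/
theorem cmAdelicDet_cmConjPlaneTorusInr (hb0 : ∀ i, b i ≠ 0) (u : CMAdelicOne F) :
    cmAdelicDet F a ha0 (cmConjPlaneTorusInr F a b g₀ hg₀ u) = u := by
  rw [cmConjPlaneTorusInr, MonoidHom.comp_apply, MonoidHom.inr_apply, cmAdelicDet_cmConjPlaneTorus F a b ha0 g₀ hg₀ hb0, one_mul]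

end Det

/-! ## §2 The η-split of record at the det-twist form -/

namespace ArchSideTerm

section EtaDetTwist

variable {L : CMField} {ι₁ : L →+* ℂ} (V : HermSpace3 L ι₁) (S : StubTree.SeesawDatum L)
  (χV χW : CMAdelicOne (L : Type) →* ℂˣ)

/-- `η₀(v, u) = χ_V(det v) · χ_W(u)` at `η = (χ_V∘det) ⊠ (χ_W∘det)`. -/
theorem eta₀_detTwist_apply (v : CMAdelic (L : Type) (frameD V)) (u : CMAdelicOne (L : Type)) :
    eta₀ V S (cmDetTwistChar (L : Type) (frameD V) (frameD_ne V) (dW S) (dW_ne S) χV χW) (v, u) =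
      χV (cmAdelicDet (L : Type) (frameD V) (frameD_ne V) v) * χW u := by
  change cmDetTwistChar (L : Type) (frameD V) (frameD_ne V) (dW S) (dW_ne S) χV χW (v, cmPlaneTorusInl (L : Type) (dW S) u) = _
  rw [cmDetTwistChar_apply, cmAdelicDet_cmPlaneTorusInl]

/-- `η₁(v, u) = χ_W(u)`. -/
theorem eta₁_detTwist_apply (v : CMAdelic (L : Type) (frameD V)) (u : CMAdelicOne (L : Type)) :
    eta₁ V S (cmDetTwistChar (L : Type) (frameD V) (frameD_ne V) (dW S) (dW_ne S) χV χW) (v, u) = χW u := by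
  change cmDetTwistChar (L : Type) (frameD V) (frameD_ne V) (dW S) (dW_ne S) χV χW (1, cmPlaneTorusInr (L : Type) (dW S) u) = _
  rw [cmDetTwistChar_apply, cmAdelicDet_cmPlaneTorusInr, map_one, map_one, one_mul]

/-- `η₂(v, u) = χ_V(det v) · χ_W(u)` (conjugated plane). -/
theorem eta₂_detTwist_apply (v : CMAdelic (L : Type) (frameD V)) (u : CMAdelicOne (L : Type)) :
    eta₂ V S (cmDetTwistChar (L : Type) (frameD V) (frameD_ne V) (dW S) (dW_ne S) χV χW) (v, u) =
      χV (cmAdelicDet (L : Type) (frameD V) (frameD_ne V) v) * χW u := by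
  change cmDetTwistChar (L : Type) (frameD V) (frameD_ne V) (dW S) (dW_ne S) χV χW
      (v, cmConjPlaneTorusInl (L : Type) (dW S) (dW' S) S.isoGL (isoGL_hg₀ S) u) = _
  rw [cmDetTwistChar_apply, cmAdelicDet_cmConjPlaneTorusInl _ _ _ _ _ _ (dW'_ne S)]

/-- `η₃(v, u) = χ_W(u)` (conjugated plane). -/
theorem eta₃_detTwist_apply (v : CMAdelic (L : Type) (frameD V)) (u : CMAdelicOne (L : Type)) :
    eta₃ V S (cmDetTwistChar (L : Type) (frameD V) (frameD_ne V) (dW S) (dW_ne S) χV χW) (v, u) = χW u := by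
  change cmDetTwistChar (L : Type) (frameD V) (frameD_ne V) (dW S) (dW_ne S) χV χW
      (1, cmConjPlaneTorusInr (L : Type) (dW S) (dW' S) S.isoGL (isoGL_hg₀ S) u) = _
  rw [cmDetTwistChar_apply, cmAdelicDet_cmConjPlaneTorusInr _ _ _ _ _ _ (dW'_ne S), map_one, map_one, one_mul]

/-- **the η-factor of (J-μ)_k is ONE character for all four lines**: at `v = 1`, `eta_k … (1, u) = χ_W(u)`, k = 0, 1, 2, 3. -/
theorem eta_detTwist_one_apply (u : CMAdelicOne (L : Type)) (k : Fin 4) :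
    (![eta₀ V S (cmDetTwistChar (L : Type) (frameD V) (frameD_ne V) (dW S) (dW_ne S) χV χW),
       eta₁ V S (cmDetTwistChar (L : Type) (frameD V) (frameD_ne V) (dW S) (dW_ne S) χV χW),
       eta₂ V S (cmDetTwistChar (L : Type) (frameD V) (frameD_ne V) (dW S) (dW_ne S) χV χW),
       eta₃ V S (cmDetTwistChar (L : Type) (frameD V) (frameD_ne V) (dW S) (dW_ne S) χV χW)] k) (1, u) = χW u := by
  fin_cases k
  · show eta₀ V S _ (1, u) = _
    rw [eta₀_detTwist_apply, map_one, map_one, one_mul]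
  · exact eta₁_detTwist_apply V S χV χW 1 u
  · show eta₂ V S _ (1, u) = _
    rw [eta₂_detTwist_apply, map_one, map_one, one_mul]
  · exact eta₃_detTwist_apply V S χV χW 1 u

end EtaDetTwist

end ArchSideTerm

/-! ## §3 The shared η family terms for Stage B -/

namespace EtaChi

variable
  (χV χW : ∀ {L : CMField} {ι₁ : L →+* ℂ} (_V : HermSpace3 L ι₁) (_c : SeesawCtx L),
    ContinuousMonoidHom (Literature.NumberTheory.Automorphic.relNormOneIdeles (maximalRealSubfield (L : Type)) (L : Type) ⧸
      Literature.NumberTheory.Automorphic.relNormOneRat (maximalRealSubfield (L : Type)) (L : Type)) Circle)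

/-- **the η family at the det-twist form of record**: `η V c = (χ_V V c ∘ det_{frameD V}) · (χ_W V c ∘ det_{dW c.D})`
(the W block `wmInputCM₂b`'s η, verbatim, as a family in `(V, c)`).  Reducible. -/
abbrev η : ∀ {L : CMField} {ι₁ : L →+* ℂ} (V : HermSpace3 L ι₁) (c : SeesawCtx L),
    CMAdelic (L : Type) (frameD V) × CMAdelic (L : Type) (dW c.D) →* ℂˣ :=
  fun {L : CMField} {ι₁ : L →+* ℂ} (V : HermSpace3 L ι₁) (c : SeesawCtx L) =>
    cmDetTwistChar (L : Type) (frameD V) (frameD_ne V) (dW c.D) (dW_ne c.D)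
      (charOfUnitaryLineChar (L : Type) (χV V c)) (charOfUnitaryLineChar (L : Type) (χW V c))

/-- **`hη` for the family**: trivial on the rational points (automorphy of `χ_V`, `χ_W` by their quotient type). -/
theorem hη : ∀ {L : CMField} {ι₁ : L →+* ℂ} (V : HermSpace3 L ι₁) (c : SeesawCtx L),
    ∀ γU ∈ CMRat (L : Type) (frameD V), ∀ γ ∈ CMRat (L : Type) (dW c.D), η @χV @χW V c (γU, γ) = 1 :=
  fun {L : CMField} {ι₁ : L →+* ℂ} (V : HermSpace3 L ι₁) (c : SeesawCtx L) =>
    cmDetTwistChar_eq_one_of_unitaryLineChar (L : Type) (frameD V) (frameD_ne V) (dW c.D) (dW_ne c.D) (χV V c) (χW V c)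

/-- **`hηc` for the family**: continuous values. -/
theorem hηc : ∀ {L : CMField} {ι₁ : L →+* ℂ} (V : HermSpace3 L ι₁) (c : SeesawCtx L),
    Continuous fun p => ((η @χV @χW V c p : ℂˣ) : ℂ) :=
  fun {L : CMField} {ι₁ : L →+* ℂ} (V : HermSpace3 L ι₁) (c : SeesawCtx L) =>
    continuous_cmDetTwistChar_of_unitaryLineChar (L : Type) (frameD V) (frameD_ne V) (dW c.D) (dW_ne c.D) (χV V c) (χW V c)

/-- read-back at a context (definitional). -/
theorem η_apply {L : CMField} {ι₁ : L →+* ℂ} (V : HermSpace3 L ι₁) (c : SeesawCtx L)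
    (p : CMAdelic (L : Type) (frameD V) × CMAdelic (L : Type) (dW c.D)) :
    η @χV @χW V c p =
      charOfUnitaryLineChar (L : Type) (χV V c) (cmAdelicDet (L : Type) (frameD V) (frameD_ne V) p.1) *
        charOfUnitaryLineChar (L : Type) (χW V c) (cmAdelicDet (L : Type) (dW c.D) (dW_ne c.D) p.2) := rfl

/-- **the η-factor of (J-μ)_k at the family, every line**: `eta_k V c.D (η V c) (1, u) = χ_W V c (ū)`. -/
theorem eta_one_apply {L : CMField} {ι₁ : L →+* ℂ} (V : HermSpace3 L ι₁) (c : SeesawCtx L) (u : CMAdelicOne (L : Type)) (k : Fin 4) :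
    (![ArchSideTerm.eta₀ V c.D (η @χV @χW V c), ArchSideTerm.eta₁ V c.D (η @χV @χW V c),
       ArchSideTerm.eta₂ V c.D (η @χV @χW V c), ArchSideTerm.eta₃ V c.D (η @χV @χW V c)] k) (1, u) =
      charOfUnitaryLineChar (L : Type) (χW V c) u :=
  ArchSideTerm.eta_detTwist_one_apply V c.D _ _ u k

variable (nV nW : ∀ {L : CMField} {ι₁ : L →+* ℂ} (_V : HermSpace3 L ι₁) (_c : SeesawCtx L), NumberField.InfinitePlace (L : Type) → ℤ)

/-- **TERM form of a character family of prescribed archimedean types** `n V c` (unitary-1 `unitaryLineCharOfType`, chosen once from the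
tree existence theorem `exists_unitaryLineChar_hasArchType`).  Reducible. -/
abbrev χOfType (n : ∀ {L : CMField} {ι₁ : L →+* ℂ} (_V : HermSpace3 L ι₁) (_c : SeesawCtx L), NumberField.InfinitePlace (L : Type) → ℤ) :
    ∀ {L : CMField} {ι₁ : L →+* ℂ} (_V : HermSpace3 L ι₁) (_c : SeesawCtx L),
      ContinuousMonoidHom (Literature.NumberTheory.Automorphic.relNormOneIdeles (maximalRealSubfield (L : Type)) (L : Type) ⧸
        Literature.NumberTheory.Automorphic.relNormOneRat (maximalRealSubfield (L : Type)) (L : Type)) Circle :=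
  fun {L : CMField} {ι₁ : L →+* ℂ} (V : HermSpace3 L ι₁) (c : SeesawCtx L) => unitaryLineCharOfType (n V c)

/-- its archimedean type at every context. -/
theorem hasArchType_χOfType
    (n : ∀ {L : CMField} {ι₁ : L →+* ℂ} (_V : HermSpace3 L ι₁) (_c : SeesawCtx L), NumberField.InfinitePlace (L : Type) → ℤ)
    {L : CMField} {ι₁ : L →+* ℂ} (V : HermSpace3 L ι₁) (c : SeesawCtx L) :
    UnitaryLineChar.HasArchType (L : Type) (χOfType @n V c) (n V c) :=
  hasArchType_unitaryLineCharOfType (n V c)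

end EtaChi

end HodgeCM.Model

end
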